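import Literature.NumberTheory.LFunctions.RodgersTaoZeroDynamicsProofs
import HarnessLib

/-!
# Rodgers–Tao 2020, towards Theorem 9 (49): the Poisson representation of `Im H_t′/H_t` over the zeros

Trunk T-ANT (`Literature/NumberTheory/LFunctions`). PROOFS ONLY: no definition, no named fact.
LINE 1 — LABEL: RH-FREE literature (Rodgers–Tao 2020, §3); bears_on LADDER-RH N-C/N-P
(COLUMN 3, DBN). WHAT THIS IS NOT: statements about `H_t` at a time `t` above a real-rooted time
(vacuous for `ζ` at `t < 0` since the tree proves `Λ ≥ 0`; RH's business at `t = 0`). Nothing in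
this file bears on the truth of RH.

## What is proved (stage A of an effective proof of Theorem 9 (49))

B. Rodgers, T. Tao, *The de Bruijn–Newman constant is non-negative*, Forum Math. Pi 8 (2020) e6.
The printed proof of (49) `N_t([T, T+α log₊T]) = α log²₊T/(4π) + o(log²₊T)` (p. 25) is a
normal-families argument on `F_n(z) = log(H_{t_n}(T_n + z log₊T_n)/…)/log²₊T_n`, whose only input
about the zeros is that `F_n′ = (1/log₊ T_n)·H′_{t_n}/H_{t_n}(T_n + z log₊T_n)` sees them through
the Hadamard (partial-fraction) product of `H_t` — classical (Laguerre–Pólya), in-tree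
`isHadamardSeq_deBruijnZero` (whose cite points at Theorem 11, p. 27, the zero dynamics, where the
source uses it). This file isolates that input in quantitative form, for
`t` above a real-rooted time (all zeros `±x_j(t)` real and simple, `isHadamardSeq_deBruijnZero`):

* `RodgersTaoLogDerivPoisson.im_logDeriv_deBruijnH_eq_tsum` — for real `u` and `Y > 0`,
  `Im (H_t′/H_t)(u − iY) = Σ_{j≥1} [Y/((u − x_j)² + Y²) + Y/((u + x_j)² + Y²)]` (the Poisson
  integral at height `Y` of the zero counting measure); `summable_poisson_terms`;
  `im_logDeriv_deBruijnH_pos` (`> 0`).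
* `RodgersTaoLogDerivPoisson.deBruijnZeroCount_Icc_le_mul_im_logDeriv` — the local zero density
  is controlled by the logarithmic derivative at the matching height:
  `N_t([c − Y, c + Y]) ≤ 2Y · Im (H_t′/H_t)(c − iY)`.
* `RodgersTaoLogDerivPoisson.continuous_logDeriv_deBruijnH_line`,
  `hasSum_integral_poisson_terms`, `hasSum_arctan_profile` and
  `integral_im_logDeriv_deBruijnH_eq_tsum` — `∫_a^b Im (H_t′/H_t)(u − iY) du =
  Σ_{j≥1} ([arctan((b−x_j)/Y) − arctan((a−x_j)/Y)] + [arctan((b+x_j)/Y) − arctan((a+x_j)/Y)])`,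
  the arctan counting profile (termwise integration by dominated convergence).
* `RodgersTaoLogDerivPoisson.deBruijnZeroCount_Icc_mul_arctan_le` — the UPPER COUNT: if
  `Im (H_t′/H_t)(u − iY) ≤ M` on `[a − η, b + η]` then `N_t([a, b]) · 2 arctan(η/Y) ≤ M (b − a + 2η)`
  (every zero in `[a, b]` has profile `≥ 2 arctan(η/Y)` over the enlarged window). With
  `Y = δ log₊ T`, `η = η₀ log₊ T`, `M = (1/4 + o(1)) log₊ T` this is the upper half of (49) up to
  the factor `π/(2 arctan(η₀/δ)) → 1` (`δ/η₀ → 0`).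
* `RodgersTaoLogDerivPoisson.mul_le_pi_mul_deBruijnZeroCount_add_tsum` — the LOWER COUNT up to
  out-of-window profiles: if `Im (H_t′/H_t)(u − iY) ≥ m` on `[a + η, b − η]` then
  `m (b − a − 2η) ≤ π N_t([a, b]) + Σ_j (profiles over [a+η, b−η] of the zeros ±x_j ∉ [a, b])`; the
  remaining sum is small at scale `Y` away from the window and is to be bounded by local zero
  densities (`deBruijnZeroCount_Icc_le_mul_im_logDeriv` at the dyadic scales, (48) far away).
* `RodgersTaoLogDerivPoisson.profile_le_div_of_right`, `profile_le_mul_div_sq_of_right`,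
  `profile_le_of_left` — decay of the profile of a point at distance `d` outside the window:
  `≤ Y/d` and `≤ (b′ − a′)·Y/(Y² + d²)` (the weights of the tail estimate).
* **`RodgersTaoLogDerivPoisson.tsum_outside_profiles_le`** — the C-TAILS estimate WITHOUT dyadic
  decompositions: the out-of-window remainder of `mul_le_pi_mul_deBruijnZeroCount_add_tsum` is
  `≤ (b − a − 2η)(2Y/η)·(Im (H_t′/H_t)((a+η) − iη) + Im (H_t′/H_t)((b−η) − iη))` (every zero outside
  `[a,b]` is at distance `≥ η` from the shrunk window, where its profile is
  `≤ (b−a−2η)Y/d² ≤ (b−a−2η)(2Y/η)·Poisson_η(d)`, and the Poisson kernels at height `η` over all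
  zeros sum to `Im H_t′/H_t` at height `η`). With `Y = δL`, `η = η₀L` and stage B at height `η`
  this is `O(δ/η₀)·(b − a)·L`.
* **`RodgersTaoLogDerivPoisson.count_window_upper`, `count_window_lower`** — STAGE C ASSEMBLED AT
  ONE WINDOW `[T, T + αL]`: from `Im H_t′/H_t ≤ (1/4 + E)L` at height `δL` on
  `[T − η₀L, T + (α+η₀)L]`: `N_t([T, T+αL])·2 arctan(η₀/δ) ≤ (1/4 + E)(α + 2η₀)L²`; from
  `Im H_t′/H_t ≥ (1/4 − E)L` at height `δL` on `[T + η₀L, T + (α−η₀)L]` and `≤ (1/4 + E)L` at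
  height `η₀L` at the two endpoints: `(1/4 − E)(α − 2η₀)L² ≤ π N_t([T, T+αL]) + α(4δ/η₀)(1/4+E)L²`.
  What remains for (49) is the choice `η₀ ≍ ε`, `δ ≍ ε·η₀/C` and `E = Cst·L^{−θ}` from stage B
  (`RodgersTaoLogDerivPropagation.exists_im_logDeriv_bounds`), i.e. bookkeeping.

These are the tools for an effective version of (49) (no subsequences): the location of
`H_t′/H_t` at height `δ log₊ T` (to be propagated from height `κ log₊ T`, where Lemma 2.1 (9)
gives it, by a three-circles estimate) then yields the zero count on `[T, T + α log₊ T]` through the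
arctan profile, with the boundary layers controlled by the local density bound.

## References

* B. Rodgers, T. Tao, *The de Bruijn–Newman constant is non-negative*, Forum Math. Pi 8 (2020),
  e6 = arXiv:1801.05914: Theorem 9 (49) and its proof pp. 23–25; cf. Theorem 11 p. 27 (zero
  dynamics; the partial fractions of `H_t′/H_t` used there are classical). [RodgersTaoFMP2020]
-/

noncomputable section

open Complex Set Filter Topology
open scoped Real

namespace Literature.NumberTheory.LFunctions

namespace RodgersTaoLogDerivPoisson

/-! ## Partial fractions over the enumerated zeros and the Poisson kernel -/

/-- `Im (1/((u − iY) − x)) = Y/((u − x)² + Y²)` for real `u, Y, x`. [folklore] -/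
private theorem im_inv_sub (u Y x : ℝ) :
    (((u : ℂ) - Y * I - x)⁻¹).im = Y / ((u - x) ^ 2 + Y ^ 2) := by
  rw [Complex.inv_im, Complex.normSq_apply]
  simp only [Complex.sub_re, Complex.sub_im, Complex.ofReal_re, Complex.ofReal_im, Complex.mul_re,
    Complex.mul_im, Complex.I_re, Complex.I_im]
  ring_nf

/-- `Im (1/((u − iY) + x)) = Y/((u + x)² + Y²)` for real `u, Y, x`. [folklore] -/
private theorem im_inv_add (u Y x : ℝ) :
    (((u : ℂ) - Y * I + x)⁻¹).im = Y / ((u + x) ^ 2 + Y ^ 2) := by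
  have := im_inv_sub u Y (-x)
  simp only [Complex.ofReal_neg, sub_neg_eq_add] at this
  rw [this]

/-- `H_t` does not vanish off the real axis when `t` lies above a real-rooted time. [folklore] -/
private theorem deBruijnH_ne_zero_of_im_ne {t : ℝ}
    (hΛ : ∃ t₁ : ℝ, t₁ < t ∧ HasOnlyRealZeros (deBruijnH t₁)) {z : ℂ} (hz : z.im ≠ 0) :
    deBruijnH t z ≠ 0 :=
  fun h ↦ hz (hasOnlyRealZeros_of_exists_lt hΛ z h)

/-- The `j`-th partial-fraction term of `H_t'/H_t` at `z = u − iY` over the zero pair `±x_{j+1}(t)`: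
`2 c z/(1 + c z²) = 1/(z − x) + 1/(z + x)` for `c = −1/x²`. [folklore] -/
private theorem term_eq {t : ℝ} (hΛ : ∃ t₁ : ℝ, t₁ < t ∧ HasOnlyRealZeros (deBruijnH t₁))
    {z : ℂ} (hz : deBruijnH t z ≠ 0) (j : ℕ) :
    2 * (-1 / ((deBruijnZero t (j + 1) : ℝ) : ℂ) ^ 2) * z /
        (1 + -1 / ((deBruijnZero t (j + 1) : ℝ) : ℂ) ^ 2 * z ^ 2) =
      (z - deBruijnZero t (j + 1))⁻¹ + (z + deBruijnZero t (j + 1))⁻¹ := by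
  have hx : ((deBruijnZero t (j + 1) : ℝ) : ℂ) ≠ 0 := by
    exact_mod_cast (deBruijnZero_pos hΛ (by omega : 1 ≤ j + 1)).ne'
  refine term_eq_inv_add_inv ?_ ((isHadamardSeq_deBruijnZero hΛ).factor_ne_zero hz j)
  field_simp

/-- **Poisson representation of `Im H_t'/H_t` below the real axis.** For `t` above a real-rooted
time, real `u` and `Y > 0`:
`Im (H_t'/H_t)(u − iY) = Σ_{j ≥ 1} [Y/((u − x_j(t))² + Y²) + Y/((u + x_j(t))² + Y²)]`, the Poisson
integral at height `Y` of the zero counting measure of `H_t` (zeros `±x_j(t)`, all real and simple),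
from the Hadamard product `H_t(z) = H_t(0) ∏_j (1 − z²/x_j(t)²)` (`isHadamardSeq_deBruijnZero`, the
tree's form of [RodgersTaoFMP2020, Thm. 11 p. 27] / the genus-0 factorisation used in the proof of
Theorem 9 (49), p. 25: «F_n′ = (1/log₊T_n)·H′_{t_n}/H_{t_n}(T_n + z log₊ T_n)»).
[cite: RodgersTaoFMP2020, Theorem 9 (49) proof p.25 (F_n′ = H′/H rescaled); cf. Theorem 11 p.27 (zero dynamics) — the partial-fraction/Hadamard product of H_t is classical, in-tree `isHadamardSeq_deBruijnZero`] -/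
theorem im_logDeriv_deBruijnH_eq_tsum {t : ℝ}
    (hΛ : ∃ t₁ : ℝ, t₁ < t ∧ HasOnlyRealZeros (deBruijnH t₁)) (u : ℝ) {Y : ℝ} (hY : 0 < Y) :
    (logDeriv (deBruijnH t) ((u : ℂ) - Y * I)).im =
      ∑' j : ℕ, (Y / ((u - deBruijnZero t (j + 1)) ^ 2 + Y ^ 2) +
        Y / ((u + deBruijnZero t (j + 1)) ^ 2 + Y ^ 2)) := by
  set z : ℂ := (u : ℂ) - Y * I with hzdef
  have hzim : z.im = -Y := by simp [hzdef]
  have hz : deBruijnH t z ≠ 0 := deBruijnH_ne_zero_of_im_ne hΛ (by rw [hzim]; linarith)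
  have h := isHadamardSeq_deBruijnZero hΛ
  rw [h.logDeriv_eq hz, Complex.im_tsum (summable_logDeriv_terms h.summable z)]
  refine tsum_congr fun j ↦ ?_
  rw [term_eq hΛ hz j, Complex.add_im, hzdef, im_inv_sub, im_inv_add]

/-- The Poisson terms over the zeros are summable (they are the imaginary parts of the absolutely
convergent partial-fraction series of `H_t'/H_t`). [cite: RodgersTaoFMP2020, Theorem 9 (49) proof p.25 (F_n′ = H′/H rescaled); cf. Theorem 11 p.27 (zero dynamics) — the partial-fraction/Hadamard product of H_t is classical, in-tree `isHadamardSeq_deBruijnZero`] -/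
theorem summable_poisson_terms {t : ℝ}
    (hΛ : ∃ t₁ : ℝ, t₁ < t ∧ HasOnlyRealZeros (deBruijnH t₁)) (u : ℝ) {Y : ℝ} (hY : 0 < Y) :
    Summable fun j : ℕ ↦ Y / ((u - deBruijnZero t (j + 1)) ^ 2 + Y ^ 2) +
      Y / ((u + deBruijnZero t (j + 1)) ^ 2 + Y ^ 2) := by
  set z : ℂ := (u : ℂ) - Y * I with hzdef
  have hzim : z.im = -Y := by simp [hzdef]
  have hz : deBruijnH t z ≠ 0 := deBruijnH_ne_zero_of_im_ne hΛ (by rw [hzim]; linarith)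
  have h := isHadamardSeq_deBruijnZero hΛ
  have hs := (Complex.hasSum_im
    (summable_logDeriv_terms h.summable z).hasSum).summable
  refine hs.congr fun j ↦ ?_
  show (2 * (-1 / ((deBruijnZero t (j + 1) : ℝ) : ℂ) ^ 2) * z /
      (1 + -1 / ((deBruijnZero t (j + 1) : ℝ) : ℂ) ^ 2 * z ^ 2)).im = _
  rw [term_eq hΛ hz j, Complex.add_im, hzdef, im_inv_sub, im_inv_add]

/-- Each one-sided family of Poisson terms is summable. [folklore] -/
private theorem summable_poisson_left {t : ℝ}
    (hΛ : ∃ t₁ : ℝ, t₁ < t ∧ HasOnlyRealZeros (deBruijnH t₁)) (u : ℝ) {Y : ℝ} (hY : 0 < Y) :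
    Summable fun j : ℕ ↦ Y / ((u - deBruijnZero t (j + 1)) ^ 2 + Y ^ 2) := by
  refine (summable_poisson_terms hΛ u hY).of_nonneg_of_le (fun j ↦ by positivity) fun j ↦ ?_
  have : 0 ≤ Y / ((u + deBruijnZero t (j + 1)) ^ 2 + Y ^ 2) := by positivity
  linarith

/-- Each one-sided family of Poisson terms is summable. [folklore] -/
private theorem summable_poisson_right {t : ℝ}
    (hΛ : ∃ t₁ : ℝ, t₁ < t ∧ HasOnlyRealZeros (deBruijnH t₁)) (u : ℝ) {Y : ℝ} (hY : 0 < Y) :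
    Summable fun j : ℕ ↦ Y / ((u + deBruijnZero t (j + 1)) ^ 2 + Y ^ 2) := by
  refine (summable_poisson_terms hΛ u hY).of_nonneg_of_le (fun j ↦ by positivity) fun j ↦ ?_
  have : 0 ≤ Y / ((u - deBruijnZero t (j + 1)) ^ 2 + Y ^ 2) := by positivity
  linarith

/-- **`Im H_t'/H_t > 0` strictly below the real axis** (for `t` above a real-rooted time): every
Poisson term is positive. [cite: RodgersTaoFMP2020, Theorem 9 (49) proof p.25 (F_n′ = H′/H rescaled); cf. Theorem 11 p.27 (zero dynamics) — the partial-fraction/Hadamard product of H_t is classical, in-tree `isHadamardSeq_deBruijnZero`] -/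
theorem im_logDeriv_deBruijnH_pos {t : ℝ}
    (hΛ : ∃ t₁ : ℝ, t₁ < t ∧ HasOnlyRealZeros (deBruijnH t₁)) (u : ℝ) {Y : ℝ} (hY : 0 < Y) :
    0 < (logDeriv (deBruijnH t) ((u : ℂ) - Y * I)).im := by
  rw [im_logDeriv_deBruijnH_eq_tsum hΛ u hY]
  exact (summable_poisson_terms hΛ u hY).tsum_pos (fun j ↦ by positivity) 0 (by positivity)

/-! ## Local zero density from the Poisson integral -/

/-- The Poisson kernel at height `Y` is at least `1/(2Y)` within distance `Y` of its centre.
[folklore] -/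
private theorem poisson_ge {Y d : ℝ} (hY : 0 < Y) (hd : |d| ≤ Y) : 1 / (2 * Y) ≤ Y / (d ^ 2 + Y ^ 2) := by
  rw [div_le_div_iff₀ (by positivity) (by positivity)]
  have : d ^ 2 ≤ Y ^ 2 := by
    rw [← sq_abs]; exact pow_le_pow_left₀ (abs_nonneg d) hd 2
  nlinarith

/-- Indices `j` with `x_{j+1}(t) ≤ X` form a finite set (`x_j(t) → ∞`). [folklore] -/
private theorem finite_indices_le {t : ℝ}
    (hΛ : ∃ t₁ : ℝ, t₁ < t ∧ HasOnlyRealZeros (deBruijnH t₁)) (X : ℝ) :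
    {j : ℕ | deBruijnZero t (j + 1) ≤ X}.Finite := by
  obtain ⟨N, hN⟩ := (tendsto_atTop_atTop.1 (tendsto_deBruijnZero_atTop hΛ)) (X + 1)
  refine (Set.finite_lt_nat N).subset fun j hj ↦ ?_
  by_contra hlt
  have hle : N ≤ j + 1 := by simp only [Set.mem_setOf_eq, not_lt] at hlt; omega
  have := hN (j + 1) hle
  exact absurd hj (by simp only [Set.mem_setOf_eq, not_le]; linarith)

/-- Counting with the Poisson kernel: a finite set `J` of indices with `|c − ε_j x_{j+1}| ≤ Y`
(`ε = ±1` fixed) has `#J ≤ 2Y · Σ_{j ∈ J} Y/((c − ε x_{j+1})² + Y²) ≤ 2Y · Σ_j (…)`. [folklore] -/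
private theorem ncard_le_of_poisson {J : Set ℕ} (hJ : J.Finite) {Y : ℝ} (hY : 0 < Y) {d : ℕ → ℝ}
    (hd : ∀ j ∈ J, |d j| ≤ Y) (hs : Summable fun j ↦ Y / (d j ^ 2 + Y ^ 2)) :
    (J.ncard : ℝ) ≤ 2 * Y * ∑' j, Y / (d j ^ 2 + Y ^ 2) := by
  classical
  rw [Set.ncard_eq_toFinset_card J hJ]
  have h1 : (hJ.toFinset.card : ℝ) * (1 / (2 * Y)) ≤ ∑ j ∈ hJ.toFinset, Y / (d j ^ 2 + Y ^ 2) := by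
    rw [← nsmul_eq_mul, ← Finset.sum_const]
    exact Finset.sum_le_sum fun j hj ↦ poisson_ge hY (hd j (hJ.mem_toFinset.1 hj))
  have h2 : ∑ j ∈ hJ.toFinset, Y / (d j ^ 2 + Y ^ 2) ≤ ∑' j, Y / (d j ^ 2 + Y ^ 2) :=
    hs.sum_le_tsum _ fun j _ ↦ by positivity
  have h3 := h1.trans h2
  rw [mul_one_div, div_le_iff₀ (by positivity)] at h3
  linarith

/-- **Local zero density from the Poisson integral.** For `t` above a real-rooted time, real `c`
and `Y > 0`: `N_t([c − Y, c + Y]) ≤ 2Y · Im (H_t'/H_t)(c − iY)` — each zero within distance `Y` of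
`c` contributes at least `Y/(Y² + Y²) = 1/(2Y)` to the Poisson sum, all other terms being
nonnegative. (The quantitative content of «F_n′ → 1/4 locally uniformly … N_{t_n}([T_n, T_n + α_n log₊T_n])»
in the proof of Theorem 9 (49), p. 25: the logarithmic derivative at height `Y` controls the
number of zeros at scale `Y`.) [cite: RodgersTaoFMP2020, Theorem 9 (49) proof p.25 (F_n′ = H′/H rescaled); cf. Theorem 11 p.27 (zero dynamics) — the partial-fraction/Hadamard product of H_t is classical, in-tree `isHadamardSeq_deBruijnZero`] -/
theorem deBruijnZeroCount_Icc_le_mul_im_logDeriv {t : ℝ}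
    (hΛ : ∃ t₁ : ℝ, t₁ < t ∧ HasOnlyRealZeros (deBruijnH t₁)) (c : ℝ) {Y : ℝ} (hY : 0 < Y) :
    (deBruijnZeroCount t (Icc (c - Y) (c + Y)) : ℝ) ≤
      2 * Y * (logDeriv (deBruijnH t) ((c : ℂ) - Y * I)).im := by
  classical
  -- the zero set in the window and the index sets of the zeros `x_{j+1}`, `−x_{j+1}` it contains
  set S : Set ℝ := {x : ℝ | x ∈ Icc (c - Y) (c + Y) ∧ deBruijnH t x = 0} with hS
  set JA : Set ℕ := {j : ℕ | deBruijnZero t (j + 1) ∈ Icc (c - Y) (c + Y)} with hJA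
  set JB : Set ℕ := {j : ℕ | -deBruijnZero t (j + 1) ∈ Icc (c - Y) (c + Y)} with hJB
  have hJAf : JA.Finite :=
    (finite_indices_le hΛ (c + Y)).subset fun j hj ↦ by exact hj.2
  have hJBf : JB.Finite :=
    (finite_indices_le hΛ (Y - c)).subset fun j hj ↦ by
      have := hj.1; simp only [Set.mem_setOf_eq]; linarith
  -- every zero in the window is `x_{j+1}` with `j ∈ JA` or `−x_{j+1}` with `j ∈ JB`
  have hsub : S ⊆ (fun j : ℕ ↦ deBruijnZero t (j + 1)) '' JA ∪ (fun j : ℕ ↦ -deBruijnZero t (j + 1)) '' JB := by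
    intro x hx
    obtain ⟨hxI, hx0⟩ := hx
    obtain ⟨j, hj1, hj⟩ := exists_deBruijnZero_eq_or_eq_neg hΛ hx0
    obtain ⟨i, rfl⟩ : ∃ i : ℕ, j = i + 1 := ⟨j - 1, by omega⟩
    rcases hj with hj | hj
    · left
      refine ⟨i, ?_, hj⟩
      show deBruijnZero t (i + 1) ∈ Icc (c - Y) (c + Y)
      rw [hj]; exact hxI
    · right
      refine ⟨i, ?_, by show -deBruijnZero t (i + 1) = x; rw [hj, neg_neg]⟩
      show -deBruijnZero t (i + 1) ∈ Icc (c - Y) (c + Y)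
      rw [hj, neg_neg]; exact hxI
  have hcount : deBruijnZeroCount t (Icc (c - Y) (c + Y)) = S.ncard := rfl
  have hle : S.ncard ≤ JA.ncard + JB.ncard := by
    calc S.ncard ≤ ((fun j : ℕ ↦ deBruijnZero t (j + 1)) '' JA ∪
          (fun j : ℕ ↦ -deBruijnZero t (j + 1)) '' JB).ncard :=
          Set.ncard_le_ncard hsub ((hJAf.image _).union (hJBf.image _))
      _ ≤ ((fun j : ℕ ↦ deBruijnZero t (j + 1)) '' JA).ncard +
          ((fun j : ℕ ↦ -deBruijnZero t (j + 1)) '' JB).ncard := Set.ncard_union_le _ _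
      _ ≤ JA.ncard + JB.ncard := Nat.add_le_add (Set.ncard_image_le hJAf) (Set.ncard_image_le hJBf)
  -- Poisson counting on each index set
  have hA : (JA.ncard : ℝ) ≤ 2 * Y * ∑' j : ℕ, Y / ((c - deBruijnZero t (j + 1)) ^ 2 + Y ^ 2) := by
    refine ncard_le_of_poisson hJAf hY (d := fun j ↦ c - deBruijnZero t (j + 1)) (fun j hj ↦ ?_)
      (summable_poisson_left hΛ c hY)
    obtain ⟨h1, h2⟩ := hj
    exact abs_le.2 ⟨by linarith, by linarith⟩
  have hB : (JB.ncard : ℝ) ≤ 2 * Y * ∑' j : ℕ, Y / ((c + deBruijnZero t (j + 1)) ^ 2 + Y ^ 2) := by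
    refine ncard_le_of_poisson hJBf hY (d := fun j ↦ c + deBruijnZero t (j + 1)) (fun j hj ↦ ?_)
      (summable_poisson_right hΛ c hY)
    obtain ⟨h1, h2⟩ := hj
    exact abs_le.2 ⟨by linarith, by linarith⟩
  rw [hcount, im_logDeriv_deBruijnH_eq_tsum hΛ c hY,
    (summable_poisson_left hΛ c hY).tsum_add (summable_poisson_right hΛ c hY)]
  calc (S.ncard : ℝ) ≤ (JA.ncard : ℝ) + JB.ncard := by exact_mod_cast hle
    _ ≤ _ := by linarith

/-! ## Continuity in `u` and the integrated Poisson identity (arctan counting profile) -/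

/-- `u ↦ (H_t'/H_t)(u − iY)` is continuous for `Y > 0` (no zeros off the real axis).
[cite: RodgersTaoFMP2020, Theorem 9 (49) proof p.25 (F_n′ = H′/H rescaled); cf. Theorem 11 p.27 (zero dynamics) — the partial-fraction/Hadamard product of H_t is classical, in-tree `isHadamardSeq_deBruijnZero`] -/
theorem continuous_logDeriv_deBruijnH_line {t : ℝ}
    (hΛ : ∃ t₁ : ℝ, t₁ < t ∧ HasOnlyRealZeros (deBruijnH t₁)) {Y : ℝ} (hY : 0 < Y) :
    Continuous fun u : ℝ ↦ logDeriv (deBruijnH t) ((u : ℂ) - Y * I) := by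
  have hline : Continuous fun u : ℝ ↦ ((u : ℂ) - Y * I) := by fun_prop
  have hH : Continuous fun u : ℝ ↦ deBruijnH t ((u : ℂ) - Y * I) :=
    (differentiable_deBruijnH_holds t).continuous.comp hline
  have hH' : Continuous fun u : ℝ ↦ deriv (deBruijnH t) ((u : ℂ) - Y * I) :=
    continuous_deriv_deBruijnH_uncurry.comp (continuous_const.prodMk hline)
  have hne : ∀ u : ℝ, deBruijnH t ((u : ℂ) - Y * I) ≠ 0 := fun u ↦
    deBruijnH_ne_zero_of_im_ne hΛ (by simp [hY.ne'])
  have e : (fun u : ℝ ↦ logDeriv (deBruijnH t) ((u : ℂ) - Y * I)) =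
      fun u : ℝ ↦ deriv (deBruijnH t) ((u : ℂ) - Y * I) / deBruijnH t ((u : ℂ) - Y * I) := by
    funext u; rw [logDeriv_apply]
  rw [e]
  exact hH'.div hH hne

/-- The Poisson kernel is continuous in the base point. [folklore] -/
private theorem continuous_poisson (x : ℝ) {Y : ℝ} (hY : 0 < Y) :
    Continuous fun u : ℝ ↦ Y / ((u - x) ^ 2 + Y ^ 2) :=
  continuous_const.div (by fun_prop) fun u ↦ by positivity

/-- `∫_a^b Y/((u − x)² + Y²) du = arctan((b − x)/Y) − arctan((a − x)/Y)`. [folklore] -/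
private theorem integral_poisson (x : ℝ) {Y : ℝ} (hY : 0 < Y) (a b : ℝ) :
    ∫ u in a..b, Y / ((u - x) ^ 2 + Y ^ 2) =
      Real.arctan ((b - x) / Y) - Real.arctan ((a - x) / Y) := by
  have hd : ∀ u : ℝ, HasDerivAt (fun u : ℝ ↦ Real.arctan ((u - x) / Y))
      (Y / ((u - x) ^ 2 + Y ^ 2)) u := by
    intro u
    have h1 : HasDerivAt (fun u : ℝ ↦ (u - x) / Y) (1 / Y) u := by
      simpa using ((hasDerivAt_id u).sub_const x).div_const Y
    have h2 := (Real.hasDerivAt_arctan ((u - x) / Y)).comp u h1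
    have e : 1 / (1 + ((u - x) / Y) ^ 2) * (1 / Y) = Y / ((u - x) ^ 2 + Y ^ 2) := by
      have : (u - x) ^ 2 + Y ^ 2 ≠ 0 := by positivity
      field_simp
      ring
    rw [e] at h2
    exact h2
  exact intervalIntegral.integral_eq_sub_of_hasDerivAt (fun u _ ↦ hd u)
    ((continuous_poisson x hY).intervalIntegrable _ _)

/-- Termwise integration of the Poisson representation (dominated convergence, all terms
nonnegative, the sum `Im H_t'/H_t` continuous): the integrals `∫_a^b` of the Poisson pair terms
sum to `∫_a^b Im (H_t'/H_t)(u − iY) du`. [cite: RodgersTaoFMP2020, Theorem 9 (49) proof p.25 (F_n′ = H′/H rescaled); cf. Theorem 11 p.27 (zero dynamics) — the partial-fraction/Hadamard product of H_t is classical, in-tree `isHadamardSeq_deBruijnZero`] -/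
theorem hasSum_integral_poisson_terms {t : ℝ}
    (hΛ : ∃ t₁ : ℝ, t₁ < t ∧ HasOnlyRealZeros (deBruijnH t₁)) {Y : ℝ} (hY : 0 < Y) (a b : ℝ) :
    HasSum (fun j : ℕ ↦ ∫ u in a..b, (Y / ((u - deBruijnZero t (j + 1)) ^ 2 + Y ^ 2) +
        Y / ((u + deBruijnZero t (j + 1)) ^ 2 + Y ^ 2)))
      (∫ u in a..b, (logDeriv (deBruijnH t) ((u : ℂ) - Y * I)).im) := by
  set F : ℕ → ℝ → ℝ := fun j u ↦ Y / ((u - deBruijnZero t (j + 1)) ^ 2 + Y ^ 2) +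
    Y / ((u + deBruijnZero t (j + 1)) ^ 2 + Y ^ 2) with hF
  have hpc : ∀ j, Continuous fun u : ℝ ↦ Y / ((u + deBruijnZero t (j + 1)) ^ 2 + Y ^ 2) := fun j ↦ by
    simpa [sub_neg_eq_add] using continuous_poisson (-deBruijnZero t (j + 1)) hY
  have hFcont : ∀ j, Continuous (F j) := fun j ↦ (continuous_poisson _ hY).add (hpc j)
  have hcont : Continuous fun u : ℝ ↦ (logDeriv (deBruijnH t) ((u : ℂ) - Y * I)).im :=
    Complex.continuous_im.comp (continuous_logDeriv_deBruijnH_line hΛ hY)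
  refine intervalIntegral.hasSum_integral_of_dominated_convergence F
    (fun j ↦ (hFcont j).aestronglyMeasurable) (fun j ↦ Eventually.of_forall fun u _ ↦ ?_)
    (Eventually.of_forall fun u _ ↦ summable_poisson_terms hΛ u hY) ?_
    (Eventually.of_forall fun u _ ↦ ?_)
  · rw [Real.norm_of_nonneg]; positivity
  · refine (hcont.intervalIntegrable a b).congr ?_
    exact fun u _ ↦ (im_logDeriv_deBruijnH_eq_tsum hΛ u hY)
  · rw [im_logDeriv_deBruijnH_eq_tsum hΛ u hY]
    exact (summable_poisson_terms hΛ u hY).hasSum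

/-- The integral of one Poisson pair term over `[a, b]` is the pair of arctan profiles. [folklore] -/
private theorem integral_poisson_pair {t : ℝ} {Y : ℝ} (hY : 0 < Y) (a b : ℝ) (j : ℕ) :
    ∫ u in a..b, (Y / ((u - deBruijnZero t (j + 1)) ^ 2 + Y ^ 2) +
        Y / ((u + deBruijnZero t (j + 1)) ^ 2 + Y ^ 2)) =
      (Real.arctan ((b - deBruijnZero t (j + 1)) / Y) -
          Real.arctan ((a - deBruijnZero t (j + 1)) / Y)) +
        (Real.arctan ((b + deBruijnZero t (j + 1)) / Y) -
          Real.arctan ((a + deBruijnZero t (j + 1)) / Y)) := by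
  have hpc : Continuous fun u : ℝ ↦ Y / ((u + deBruijnZero t (j + 1)) ^ 2 + Y ^ 2) := by
    simpa [sub_neg_eq_add] using continuous_poisson (-deBruijnZero t (j + 1)) hY
  have h1 := integral_poisson (deBruijnZero t (j + 1)) hY a b
  have h2 := integral_poisson (-deBruijnZero t (j + 1)) hY a b
  simp only [sub_neg_eq_add] at h2
  rw [intervalIntegral.integral_add ((continuous_poisson _ hY).intervalIntegrable _ _)
    (hpc.intervalIntegrable _ _), h1, h2]

/-- **The arctan counting profiles are summable**, with sum `∫_a^b Im (H_t'/H_t)(u − iY) du`.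
[cite: RodgersTaoFMP2020, Theorem 9 (49) proof p.25 (F_n′ = H′/H rescaled); cf. Theorem 11 p.27 (zero dynamics) — the partial-fraction/Hadamard product of H_t is classical, in-tree `isHadamardSeq_deBruijnZero`] -/
theorem hasSum_arctan_profile {t : ℝ}
    (hΛ : ∃ t₁ : ℝ, t₁ < t ∧ HasOnlyRealZeros (deBruijnH t₁)) {Y : ℝ} (hY : 0 < Y) (a b : ℝ) :
    HasSum (fun j : ℕ ↦ (Real.arctan ((b - deBruijnZero t (j + 1)) / Y) -
          Real.arctan ((a - deBruijnZero t (j + 1)) / Y)) +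
        (Real.arctan ((b + deBruijnZero t (j + 1)) / Y) -
          Real.arctan ((a + deBruijnZero t (j + 1)) / Y)))
      (∫ u in a..b, (logDeriv (deBruijnH t) ((u : ℂ) - Y * I)).im) := by
  have e : (fun j : ℕ ↦ (Real.arctan ((b - deBruijnZero t (j + 1)) / Y) -
          Real.arctan ((a - deBruijnZero t (j + 1)) / Y)) +
        (Real.arctan ((b + deBruijnZero t (j + 1)) / Y) -
          Real.arctan ((a + deBruijnZero t (j + 1)) / Y))) =
      fun j : ℕ ↦ ∫ u in a..b, (Y / ((u - deBruijnZero t (j + 1)) ^ 2 + Y ^ 2) +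
        Y / ((u + deBruijnZero t (j + 1)) ^ 2 + Y ^ 2)) := by
    funext j; rw [integral_poisson_pair hY a b j]
  rw [e]
  exact hasSum_integral_poisson_terms hΛ hY a b

/-- **Integrated Poisson identity (the arctan counting profile).** For `t` above a real-rooted
time, `Y > 0` and real `a, b`:
`∫_a^b Im (H_t'/H_t)(u − iY) du = Σ_{j ≥ 1} ([arctan((b−x_j)/Y) − arctan((a−x_j)/Y)] +
[arctan((b+x_j)/Y) − arctan((a+x_j)/Y)])` — each zero `±x_j(t)` enters with `π` times its angular
profile, `≈ π` well inside `[a, b]` and `≈ 0` well outside, at scale `Y`. This is the zero-counting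
device behind Theorem 9 (49) (there via the argument principle on the contour at height
`δ log₊ T`, proof p. 25); here by termwise integration of the Poisson representation.
[cite: RodgersTaoFMP2020, Theorem 9 (49) proof p.25 (F_n′ = H′/H rescaled); cf. Theorem 11 p.27 (zero dynamics) — the partial-fraction/Hadamard product of H_t is classical, in-tree `isHadamardSeq_deBruijnZero`] -/
theorem integral_im_logDeriv_deBruijnH_eq_tsum {t : ℝ}
    (hΛ : ∃ t₁ : ℝ, t₁ < t ∧ HasOnlyRealZeros (deBruijnH t₁)) {Y : ℝ} (hY : 0 < Y) (a b : ℝ) :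
    ∫ u in a..b, (logDeriv (deBruijnH t) ((u : ℂ) - Y * I)).im =
      ∑' j : ℕ, ((Real.arctan ((b - deBruijnZero t (j + 1)) / Y) -
          Real.arctan ((a - deBruijnZero t (j + 1)) / Y)) +
        (Real.arctan ((b + deBruijnZero t (j + 1)) / Y) -
          Real.arctan ((a + deBruijnZero t (j + 1)) / Y))) :=
  (hasSum_arctan_profile hΛ hY a b).tsum_eq.symm

/-! ## Counting zeros from above with the arctan profile -/

/-- The arctan profile of a point of `[a, b]` over the enlarged window `[a − η, b + η]` at scale `Y`
is at least `2 arctan(η/Y)`. [folklore] -/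
private theorem two_mul_arctan_le_profile {x a b η Y : ℝ} (hY : 0 < Y) (hx : x ∈ Icc a b) :
    2 * Real.arctan (η / Y) ≤
      Real.arctan ((b + η - x) / Y) - Real.arctan ((a - η - x) / Y) := by
  have h1 : Real.arctan (η / Y) ≤ Real.arctan ((b + η - x) / Y) :=
    Real.arctan_mono (div_le_div_of_nonneg_right (by linarith [hx.2]) hY.le)
  have h2 : Real.arctan ((a - η - x) / Y) ≤ Real.arctan ((-η) / Y) :=
    Real.arctan_mono (div_le_div_of_nonneg_right (by linarith [hx.1]) hY.le)
  rw [neg_div, Real.arctan_neg] at h2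
  linarith

/-- Each arctan profile over an interval is nonnegative. [folklore] -/
private theorem profile_nonneg {x a b Y : ℝ} (hY : 0 < Y) (hab : a ≤ b) :
    0 ≤ Real.arctan ((b - x) / Y) - Real.arctan ((a - x) / Y) := by
  have := Real.arctan_mono (div_le_div_of_nonneg_right (by linarith : a - x ≤ b - x) hY.le)
  linarith

/-- Counting with a profile: a finite index set `J` on which the profile `p j ≥ m > 0`, with
`p ≥ 0` summable, has `#J · m ≤ Σ_j p j`. [folklore] -/
private theorem ncard_mul_le_tsum {J : Set ℕ} (hJ : J.Finite) {m : ℝ} {p : ℕ → ℝ}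
    (hp0 : ∀ j, 0 ≤ p j) (hpJ : ∀ j ∈ J, m ≤ p j) (hs : Summable p) :
    (J.ncard : ℝ) * m ≤ ∑' j, p j := by
  classical
  rw [Set.ncard_eq_toFinset_card J hJ]
  calc (hJ.toFinset.card : ℝ) * m = ∑ j ∈ hJ.toFinset, m := by rw [Finset.sum_const, nsmul_eq_mul]
    _ ≤ ∑ j ∈ hJ.toFinset, p j := Finset.sum_le_sum fun j hj ↦ hpJ j (hJ.mem_toFinset.1 hj)
    _ ≤ ∑' j, p j := hs.sum_le_tsum _ fun j _ ↦ hp0 j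

/-- **Upper bound for the zero count from the logarithmic derivative at height `Y`** (the
quantitative form of the upper half of the count in the proof of Theorem 9 (49), p. 25). For `t`
above a real-rooted time, `Y > 0`, `η > 0`, `a ≤ b`: if `Im (H_t'/H_t)(u − iY) ≤ M` for all
`u ∈ [a − η, b + η]`, then `N_t([a, b]) · 2 arctan(η/Y) ≤ M · (b − a + 2η)` — every zero in
`[a, b]` has arctan profile `≥ 2 arctan(η/Y)` over the enlarged window, the profiles of all zeros
sum to `∫_{a−η}^{b+η} Im (H_t'/H_t)(u − iY) du ≤ M (b − a + 2η)`.
[cite: RodgersTaoFMP2020, Theorem 9 (49) proof p.25 (F_n′ = H′/H rescaled); cf. Theorem 11 p.27 (zero dynamics) — the partial-fraction/Hadamard product of H_t is classical, in-tree `isHadamardSeq_deBruijnZero`] -/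
theorem deBruijnZeroCount_Icc_mul_arctan_le {t : ℝ}
    (hΛ : ∃ t₁ : ℝ, t₁ < t ∧ HasOnlyRealZeros (deBruijnH t₁)) {Y η a b M : ℝ} (hY : 0 < Y)
    (hη : 0 < η) (hab : a ≤ b)
    (hM : ∀ u ∈ Icc (a - η) (b + η), (logDeriv (deBruijnH t) ((u : ℂ) - Y * I)).im ≤ M) :
    (deBruijnZeroCount t (Icc a b) : ℝ) * (2 * Real.arctan (η / Y)) ≤ M * (b - a + 2 * η) := by
  classical
  have hab' : a - η ≤ b + η := by linarith
  -- the integral bound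
  have hint : ∫ u in (a - η)..(b + η), (logDeriv (deBruijnH t) ((u : ℂ) - Y * I)).im ≤
      M * (b - a + 2 * η) := by
    have hcont : Continuous fun u : ℝ ↦ (logDeriv (deBruijnH t) ((u : ℂ) - Y * I)).im :=
      Complex.continuous_im.comp (continuous_logDeriv_deBruijnH_line hΛ hY)
    have hg : IntervalIntegrable (fun _ : ℝ ↦ M) MeasureTheory.volume (a - η) (b + η) :=
      intervalIntegrable_const
    have h1 := intervalIntegral.integral_mono_on hab' (hcont.intervalIntegrable _ _) hg
      (fun u hu ↦ hM u hu)
    rw [intervalIntegral.integral_const, smul_eq_mul] at h1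
    linarith
  -- the profiles, their sum and nonnegativity
  set pA : ℕ → ℝ := fun j ↦ Real.arctan ((b + η - deBruijnZero t (j + 1)) / Y) -
    Real.arctan ((a - η - deBruijnZero t (j + 1)) / Y) with hpA
  set pB : ℕ → ℝ := fun j ↦ Real.arctan ((b + η + deBruijnZero t (j + 1)) / Y) -
    Real.arctan ((a - η + deBruijnZero t (j + 1)) / Y) with hpB
  have hsumAB : HasSum (fun j ↦ pA j + pB j)
      (∫ u in (a - η)..(b + η), (logDeriv (deBruijnH t) ((u : ℂ) - Y * I)).im) :=
    hasSum_arctan_profile hΛ hY (a - η) (b + η)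
  have hpA0 : ∀ j, 0 ≤ pA j := fun j ↦ profile_nonneg hY hab'
  have hpB0 : ∀ j, 0 ≤ pB j := fun j ↦ by
    have h := profile_nonneg (x := -deBruijnZero t (j + 1)) hY hab'
    simp only [sub_neg_eq_add] at h
    exact h
  have hsA : Summable pA :=
    hsumAB.summable.of_nonneg_of_le hpA0 fun j ↦ by linarith [hpB0 j]
  have hsB : Summable pB :=
    hsumAB.summable.of_nonneg_of_le hpB0 fun j ↦ by linarith [hpA0 j]
  -- the zeros in `[a, b]` and their indices
  set S : Set ℝ := {x : ℝ | x ∈ Icc a b ∧ deBruijnH t x = 0} with hS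
  set JA : Set ℕ := {j : ℕ | deBruijnZero t (j + 1) ∈ Icc a b} with hJA
  set JB : Set ℕ := {j : ℕ | -deBruijnZero t (j + 1) ∈ Icc a b} with hJB
  have hJAf : JA.Finite := (finite_indices_le hΛ b).subset fun j hj ↦ by exact hj.2
  have hJBf : JB.Finite := (finite_indices_le hΛ (-a)).subset fun j hj ↦ by
    have := hj.1; simp only [Set.mem_setOf_eq]; linarith
  have hsub : S ⊆ (fun j : ℕ ↦ deBruijnZero t (j + 1)) '' JA ∪
      (fun j : ℕ ↦ -deBruijnZero t (j + 1)) '' JB := by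
    intro x hx
    obtain ⟨hxI, hx0⟩ := hx
    obtain ⟨j, hj1, hj⟩ := exists_deBruijnZero_eq_or_eq_neg hΛ hx0
    obtain ⟨i, rfl⟩ : ∃ i : ℕ, j = i + 1 := ⟨j - 1, by omega⟩
    rcases hj with hj | hj
    · left
      refine ⟨i, ?_, hj⟩
      show deBruijnZero t (i + 1) ∈ Icc a b
      rw [hj]; exact hxI
    · right
      refine ⟨i, ?_, by show -deBruijnZero t (i + 1) = x; rw [hj, neg_neg]⟩
      show -deBruijnZero t (i + 1) ∈ Icc a b
      rw [hj, neg_neg]; exact hxI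
  have hcount : deBruijnZeroCount t (Icc a b) = S.ncard := rfl
  have hle : S.ncard ≤ JA.ncard + JB.ncard := by
    calc S.ncard ≤ ((fun j : ℕ ↦ deBruijnZero t (j + 1)) '' JA ∪
          (fun j : ℕ ↦ -deBruijnZero t (j + 1)) '' JB).ncard :=
          Set.ncard_le_ncard hsub ((hJAf.image _).union (hJBf.image _))
      _ ≤ ((fun j : ℕ ↦ deBruijnZero t (j + 1)) '' JA).ncard +
          ((fun j : ℕ ↦ -deBruijnZero t (j + 1)) '' JB).ncard := Set.ncard_union_le _ _
      _ ≤ JA.ncard + JB.ncard := Nat.add_le_add (Set.ncard_image_le hJAf) (Set.ncard_image_le hJBf)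
  -- profile counting on each index set
  have hA : (JA.ncard : ℝ) * (2 * Real.arctan (η / Y)) ≤ ∑' j, pA j :=
    ncard_mul_le_tsum hJAf hpA0 (fun j hj ↦ two_mul_arctan_le_profile hY hj) hsA
  have hB : (JB.ncard : ℝ) * (2 * Real.arctan (η / Y)) ≤ ∑' j, pB j :=
    ncard_mul_le_tsum hJBf hpB0 (fun j hj ↦ by
      have h := two_mul_arctan_le_profile (x := -deBruijnZero t (j + 1)) (η := η) hY hj
      simp only [sub_neg_eq_add] at h
      exact h) hsB
  have htot : ∑' j, pA j + ∑' j, pB j ≤ M * (b - a + 2 * η) := by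
    rw [← hsA.tsum_add hsB, hsumAB.tsum_eq]; exact hint
  have harc : 0 ≤ 2 * Real.arctan (η / Y) := by
    have := Real.arctan_nonneg.2 (div_pos hη hY).le; linarith
  rw [hcount]
  calc (S.ncard : ℝ) * (2 * Real.arctan (η / Y))
      ≤ ((JA.ncard : ℝ) + JB.ncard) * (2 * Real.arctan (η / Y)) := by
        refine mul_le_mul_of_nonneg_right ?_ harc
        exact_mod_cast hle
    _ ≤ M * (b - a + 2 * η) := by rw [add_mul]; linarith

/-! ## Counting zeros from below with the arctan profile (up to out-of-window profiles) -/

/-- An arctan profile is `< π`. [folklore] -/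
private theorem profile_lt_pi (p q : ℝ) : Real.arctan p - Real.arctan q < π := by
  have h1 := Real.arctan_lt_pi_div_two p
  have h2 := Real.neg_pi_div_two_lt_arctan q
  linarith

/-- A `tsum` supported on a finite index set on which the terms are `≤ π` is at most `π · #J`.
[folklore] -/
private theorem tsum_indicator_le {J : Set ℕ} (hJ : J.Finite) {p : ℕ → ℝ} (hp : ∀ j, p j ≤ π) :
    ∑' j, J.indicator p j ≤ π * J.ncard := by
  classical
  rw [tsum_eq_sum (s := hJ.toFinset) (fun j hj ↦ by
    rw [Set.indicator_of_notMem (fun h ↦ hj (hJ.mem_toFinset.2 h))]),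
    Set.ncard_eq_toFinset_card J hJ]
  calc ∑ j ∈ hJ.toFinset, J.indicator p j ≤ ∑ j ∈ hJ.toFinset, π :=
        Finset.sum_le_sum fun j hj ↦ by
          rw [Set.indicator_of_mem (hJ.mem_toFinset.1 hj)]; exact hp j
    _ = π * hJ.toFinset.card := by rw [Finset.sum_const, nsmul_eq_mul, mul_comm]

/-- The indices of the zeros `x_{j+1} ∈ [a,b]` and of the zeros `−x_{j+1} ∈ [a,b]` number at most
`N_t([a,b])` together (the two families are injective with disjoint images inside the zero set).
[folklore] -/
private theorem ncard_indices_le_count {t : ℝ}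
    (hΛ : ∃ t₁ : ℝ, t₁ < t ∧ HasOnlyRealZeros (deBruijnH t₁)) (a b : ℝ) :
    {j : ℕ | deBruijnZero t (j + 1) ∈ Icc a b}.ncard +
        {j : ℕ | -deBruijnZero t (j + 1) ∈ Icc a b}.ncard ≤ deBruijnZeroCount t (Icc a b) := by
  classical
  set S : Set ℝ := {x : ℝ | x ∈ Icc a b ∧ deBruijnH t x = 0} with hS
  set JA : Set ℕ := {j : ℕ | deBruijnZero t (j + 1) ∈ Icc a b} with hJA
  set JB : Set ℕ := {j : ℕ | -deBruijnZero t (j + 1) ∈ Icc a b} with hJB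
  have hSf : S.Finite := finite_real_zeros_deBruijnH_Icc t a b
  set f : ℕ → ℝ := fun j ↦ deBruijnZero t (j + 1) with hf
  set g : ℕ → ℝ := fun j ↦ -deBruijnZero t (j + 1) with hg
  have hmono := strictMono_deBruijnZero hΛ
  have hfinj : Function.Injective f := fun i j h ↦ by
    have := hmono.injective h; omega
  have hginj : Function.Injective g := fun i j h ↦ by
    have := hmono.injective (neg_injective h); omega
  have hfS : f '' JA ⊆ S := by
    rintro x ⟨j, hj, rfl⟩
    exact ⟨hj, deBruijnH_deBruijnZero hΛ (by omega)⟩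
  have hgS : g '' JB ⊆ S := by
    rintro x ⟨j, hj, rfl⟩
    refine ⟨hj, ?_⟩
    show deBruijnH t (((-deBruijnZero t (j + 1) : ℝ) : ℂ)) = 0
    rw [Complex.ofReal_neg, deBruijnH_neg]
    exact deBruijnH_deBruijnZero hΛ (by omega)
  have hdisj : Disjoint (f '' JA) (g '' JB) := by
    refine Set.disjoint_left.2 ?_
    rintro x ⟨j, -, rfl⟩ ⟨j', -, h⟩
    have h1 : 0 < deBruijnZero t (j + 1) := deBruijnZero_pos hΛ (by omega)
    have h2 : 0 < deBruijnZero t (j' + 1) := deBruijnZero_pos hΛ (by omega)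
    have : g j' = f j := h
    simp only [hf, hg] at this
    linarith
  have hcount : deBruijnZeroCount t (Icc a b) = S.ncard := rfl
  rw [hcount, ← Set.ncard_image_of_injective JA hfinj, ← Set.ncard_image_of_injective JB hginj,
    ← Set.ncard_union_eq hdisj (hSf.subset hfS) (hSf.subset hgS)]
  exact Set.ncard_le_ncard (Set.union_subset hfS hgS) hSf

/-- **Lower bound for the zero count from the logarithmic derivative at height `Y`, up to the
out-of-window profiles** (the quantitative form of the lower half of the count in the proof of
Theorem 9 (49), p. 25). For `t` above a real-rooted time, `Y > 0`, `η > 0`, `a + η ≤ b − η`: if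
`Im (H_t'/H_t)(u − iY) ≥ m` for all `u ∈ [a + η, b − η]`, then
`m (b − a − 2η) ≤ π N_t([a, b]) + Σ_j (out-of-window profiles)`, where the profile of a real point
`x` is `arctan((b−η−x)/Y) − arctan((a+η−x)/Y) ∈ [0, π)` and the sum extends over the zeros
`±x_j(t)` NOT in `[a, b]` (their profiles are small at scale `Y` away from the window and are to be
bounded by local zero densities). Proof: the profiles of ALL zeros sum to
`∫_{a+η}^{b−η} Im (H_t'/H_t)(u − iY) du ≥ m (b − a − 2η)`; those of the zeros inside `[a, b]` are
`< π` each and there are at most `N_t([a,b])` of them.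
[cite: RodgersTaoFMP2020, Theorem 9 (49) proof p.25 (F_n′ = H′/H rescaled); cf. Theorem 11 p.27 (zero dynamics) — the partial-fraction/Hadamard product of H_t is classical, in-tree `isHadamardSeq_deBruijnZero`] -/
theorem mul_le_pi_mul_deBruijnZeroCount_add_tsum {t : ℝ}
    (hΛ : ∃ t₁ : ℝ, t₁ < t ∧ HasOnlyRealZeros (deBruijnH t₁)) {Y η a b m : ℝ} (hY : 0 < Y)
    (hab : a + η ≤ b - η)
    (hm : ∀ u ∈ Icc (a + η) (b - η), m ≤ (logDeriv (deBruijnH t) ((u : ℂ) - Y * I)).im) :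
    m * (b - a - 2 * η) ≤ π * deBruijnZeroCount t (Icc a b) +
      ∑' j : ℕ, ({j : ℕ | deBruijnZero t (j + 1) ∈ Icc a b}ᶜ.indicator
          (fun j ↦ Real.arctan ((b - η - deBruijnZero t (j + 1)) / Y) -
            Real.arctan ((a + η - deBruijnZero t (j + 1)) / Y)) j +
        {j : ℕ | -deBruijnZero t (j + 1) ∈ Icc a b}ᶜ.indicator
          (fun j ↦ Real.arctan ((b - η + deBruijnZero t (j + 1)) / Y) -
            Real.arctan ((a + η + deBruijnZero t (j + 1)) / Y)) j) := by
  classical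
  -- the integral bound from below
  have hcont : Continuous fun u : ℝ ↦ (logDeriv (deBruijnH t) ((u : ℂ) - Y * I)).im :=
    Complex.continuous_im.comp (continuous_logDeriv_deBruijnH_line hΛ hY)
  have hint : m * (b - a - 2 * η) ≤
      ∫ u in (a + η)..(b - η), (logDeriv (deBruijnH t) ((u : ℂ) - Y * I)).im := by
    have hg : IntervalIntegrable (fun _ : ℝ ↦ m) MeasureTheory.volume (a + η) (b - η) :=
      intervalIntegrable_const
    have h1 := intervalIntegral.integral_mono_on hab hg (hcont.intervalIntegrable _ _)
      (fun u hu ↦ hm u hu)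
    rw [intervalIntegral.integral_const, smul_eq_mul] at h1
    linarith
  -- profiles
  set pA : ℕ → ℝ := fun j ↦ Real.arctan ((b - η - deBruijnZero t (j + 1)) / Y) -
    Real.arctan ((a + η - deBruijnZero t (j + 1)) / Y) with hpA
  set pB : ℕ → ℝ := fun j ↦ Real.arctan ((b - η + deBruijnZero t (j + 1)) / Y) -
    Real.arctan ((a + η + deBruijnZero t (j + 1)) / Y) with hpB
  set JA : Set ℕ := {j : ℕ | deBruijnZero t (j + 1) ∈ Icc a b} with hJA
  set JB : Set ℕ := {j : ℕ | -deBruijnZero t (j + 1) ∈ Icc a b} with hJB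
  have hsumAB : HasSum (fun j ↦ pA j + pB j)
      (∫ u in (a + η)..(b - η), (logDeriv (deBruijnH t) ((u : ℂ) - Y * I)).im) :=
    hasSum_arctan_profile hΛ hY (a + η) (b - η)
  have hpA0 : ∀ j, 0 ≤ pA j := fun j ↦ profile_nonneg hY hab
  have hpB0 : ∀ j, 0 ≤ pB j := fun j ↦ by
    have h := profile_nonneg (x := -deBruijnZero t (j + 1)) hY hab
    simp only [sub_neg_eq_add] at h
    exact h
  have hsA : Summable pA :=
    hsumAB.summable.of_nonneg_of_le hpA0 fun j ↦ by linarith [hpB0 j]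
  have hsB : Summable pB :=
    hsumAB.summable.of_nonneg_of_le hpB0 fun j ↦ by linarith [hpA0 j]
  have hJAf : JA.Finite := (finite_indices_le hΛ b).subset fun j hj ↦ by exact hj.2
  have hJBf : JB.Finite := (finite_indices_le hΛ (-a)).subset fun j hj ↦ by
    have := hj.1; simp only [Set.mem_setOf_eq]; linarith
  -- split each profile family into in-window and out-of-window parts
  have hsplitA : ∀ j, pA j = JA.indicator pA j + JAᶜ.indicator pA j := fun j ↦
    (Set.indicator_self_add_compl_apply JA pA j).symm
  have hsplitB : ∀ j, pB j = JB.indicator pB j + JBᶜ.indicator pB j := fun j ↦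
    (Set.indicator_self_add_compl_apply JB pB j).symm
  have hind_le : ∀ (J : Set ℕ) (p : ℕ → ℝ), (∀ j, 0 ≤ p j) → ∀ j, J.indicator p j ≤ p j :=
    fun J p hp j ↦ Set.indicator_le_self' (fun _ _ ↦ hp _) j
  have hind_nn : ∀ (J : Set ℕ) (p : ℕ → ℝ), (∀ j, 0 ≤ p j) → ∀ j, 0 ≤ J.indicator p j :=
    fun J p hp j ↦ Set.indicator_nonneg (fun _ _ ↦ hp _) j
  have hsAin : Summable (JA.indicator pA) :=
    hsA.of_nonneg_of_le (hind_nn JA pA hpA0) (hind_le JA pA hpA0)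
  have hsAout : Summable (JAᶜ.indicator pA) :=
    hsA.of_nonneg_of_le (hind_nn JAᶜ pA hpA0) (hind_le JAᶜ pA hpA0)
  have hsBin : Summable (JB.indicator pB) :=
    hsB.of_nonneg_of_le (hind_nn JB pB hpB0) (hind_le JB pB hpB0)
  have hsBout : Summable (JBᶜ.indicator pB) :=
    hsB.of_nonneg_of_le (hind_nn JBᶜ pB hpB0) (hind_le JBᶜ pB hpB0)
  have htot : ∫ u in (a + η)..(b - η), (logDeriv (deBruijnH t) ((u : ℂ) - Y * I)).im =
      (∑' j, JA.indicator pA j + ∑' j, JB.indicator pB j) +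
        ∑' j, (JAᶜ.indicator pA j + JBᶜ.indicator pB j) := by
    rw [← hsumAB.tsum_eq, ← hsAin.tsum_add hsBin, ← (hsAin.add hsBin).tsum_add (hsAout.add hsBout)]
    refine tsum_congr fun j ↦ ?_
    show pA j + pB j = _
    rw [hsplitA j, hsplitB j]
    ring
  -- in-window parts: each `< π`, at most `N_t([a,b])` of them
  have hinA : ∑' j, JA.indicator pA j ≤ π * JA.ncard :=
    tsum_indicator_le hJAf fun j ↦ (profile_lt_pi _ _).le
  have hinB : ∑' j, JB.indicator pB j ≤ π * JB.ncard :=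
    tsum_indicator_le hJBf fun j ↦ (profile_lt_pi _ _).le
  have hN : ((JA.ncard : ℕ) : ℝ) + JB.ncard ≤ deBruijnZeroCount t (Icc a b) := by
    exact_mod_cast ncard_indices_le_count hΛ a b
  have hin : ∑' j, JA.indicator pA j + ∑' j, JB.indicator pB j ≤
      π * deBruijnZeroCount t (Icc a b) := by
    have := mul_le_mul_of_nonneg_left hN Real.pi_pos.le
    rw [mul_add] at this
    linarith
  rw [htot] at hint
  linarith


/-! ## Decay of the arctan profile away from the window (for the tail estimates of stage C) -/

/-- Mean-value bound for `arctan` on `[q, ∞)`, `q ≥ 0`: `arctan p − arctan q ≤ (p − q)/(1 + q²)`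
for `q ≤ p`. [folklore] -/
private theorem arctan_sub_arctan_le {p q : ℝ} (hq : 0 ≤ q) (hqp : q ≤ p) :
    Real.arctan p - Real.arctan q ≤ (p - q) / (1 + q ^ 2) := by
  have hD : Convex ℝ (Ici q) := convex_Ici q
  have hcont : ContinuousOn Real.arctan (Ici q) := Real.continuous_arctan.continuousOn
  have hdiff : DifferentiableOn ℝ Real.arctan (interior (Ici q)) :=
    Real.differentiable_arctan.differentiableOn
  have hle : ∀ x ∈ interior (Ici q), deriv Real.arctan x ≤ 1 / (1 + q ^ 2) := by
    intro x hx
    rw [interior_Ici] at hx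
    rw [Real.deriv_arctan]
    have hx' : q < x := hx
    have : q ^ 2 ≤ x ^ 2 := by nlinarith
    exact div_le_div_of_nonneg_left zero_le_one (by positivity) (by linarith)
  have h := hD.image_sub_le_mul_sub_of_deriv_le hcont hdiff hle q (le_refl q |> fun h ↦ mem_Ici.2 h)
    p (mem_Ici.2 hqp) hqp
  calc Real.arctan p - Real.arctan q ≤ 1 / (1 + q ^ 2) * (p - q) := h
    _ = (p - q) / (1 + q ^ 2) := by ring

/-- `arctan v ≤ v` for `v ≥ 0`. [folklore] -/
private theorem arctan_le_self {v : ℝ} (hv : 0 ≤ v) : Real.arctan v ≤ v := by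
  have := arctan_sub_arctan_le le_rfl hv
  simp only [Real.arctan_zero, sub_zero] at this
  simpa using this

/-- **Profile decay (first order).** A point at distance `d > 0` to the RIGHT of the window
`[a′, b′]` (`x = b′ + d`) has profile
`arctan((b′ − x)/Y) − arctan((a′ − x)/Y) ≤ Y/d`. (With `a′ = a + η`, `b′ = b − η` this bounds the
out-of-window profiles of `mul_le_pi_mul_deBruijnZeroCount_add_tsum` for zeros in the boundary
layer.) [cite: RodgersTaoFMP2020, Theorem 9 (49) proof p.25 (the Γ_I/Γ_III boundary contributions)] -/
theorem profile_le_div_of_right {a' b' Y d : ℝ} (hY : 0 < Y) (hd : 0 < d) :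
    Real.arctan ((b' - (b' + d)) / Y) - Real.arctan ((a' - (b' + d)) / Y) ≤ Y / d := by
  have e1 : (b' - (b' + d)) / Y = -(d / Y) := by ring
  have e2 : (a' - (b' + d)) / Y = -((d + (b' - a')) / Y) := by ring
  rw [e1, e2, Real.arctan_neg, Real.arctan_neg]
  have h1 : Real.arctan ((d + (b' - a')) / Y) < π / 2 := Real.arctan_lt_pi_div_two _
  have h2 : π / 2 - Real.arctan (d / Y) = Real.arctan ((d / Y)⁻¹) :=
    (Real.arctan_inv_of_pos (div_pos hd hY)).symm
  have h3 : Real.arctan ((d / Y)⁻¹) ≤ (d / Y)⁻¹ := arctan_le_self (by positivity)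
  have h4 : (d / Y)⁻¹ = Y / d := by rw [inv_div]
  linarith

/-- **Profile decay (second order).** A point at distance `d > 0` to the RIGHT of the window
`[a′, b′]` of width `w = b′ − a′ ≥ 0` has profile `≤ w·Y/(Y² + d²) ≤ w·Y/d²`.
[cite: RodgersTaoFMP2020, Theorem 9 (49) proof p.25 (the Γ_I/Γ_III boundary contributions)] -/
theorem profile_le_mul_div_sq_of_right {a' b' Y d : ℝ} (hY : 0 < Y) (hab : a' ≤ b') (hd : 0 < d) :
    Real.arctan ((b' - (b' + d)) / Y) - Real.arctan ((a' - (b' + d)) / Y) ≤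
      (b' - a') * Y / (Y ^ 2 + d ^ 2) := by
  have e1 : (b' - (b' + d)) / Y = -(d / Y) := by ring
  have e2 : (a' - (b' + d)) / Y = -((d + (b' - a')) / Y) := by ring
  rw [e1, e2, Real.arctan_neg, Real.arctan_neg, neg_sub_neg]
  have h := arctan_sub_arctan_le (q := d / Y) (p := (d + (b' - a')) / Y) (by positivity)
    (div_le_div_of_nonneg_right (by linarith) hY.le)
  have e3 : ((d + (b' - a')) / Y - d / Y) / (1 + (d / Y) ^ 2) = (b' - a') * Y / (Y ^ 2 + d ^ 2) := by
    field_simp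
    ring
  rw [e3] at h
  exact h

/-- **Profile decay to the LEFT** (by the symmetry `x ↦ −x` of the profile shape): a point at
distance `d > 0` to the left of `[a′, b′]` (`x = a′ − d`) has profile `≤ Y/d` and
`≤ (b′ − a′)·Y/(Y² + d²)`. [cite: RodgersTaoFMP2020, Theorem 9 (49) proof p.25 (the Γ_I/Γ_III boundary contributions)] -/
theorem profile_le_of_left {a' b' Y d : ℝ} (hY : 0 < Y) (hab : a' ≤ b') (hd : 0 < d) :
    Real.arctan ((b' - (a' - d)) / Y) - Real.arctan ((a' - (a' - d)) / Y) ≤ Y / d ∧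
      Real.arctan ((b' - (a' - d)) / Y) - Real.arctan ((a' - (a' - d)) / Y) ≤
        (b' - a') * Y / (Y ^ 2 + d ^ 2) := by
  have e1 : (b' - (a' - d)) / Y = (d + (b' - a')) / Y := by ring
  have e2 : (a' - (a' - d)) / Y = d / Y := by ring
  rw [e1, e2]
  constructor
  · have h1 : Real.arctan ((d + (b' - a')) / Y) < π / 2 := Real.arctan_lt_pi_div_two _
    have h2 : π / 2 - Real.arctan (d / Y) = Real.arctan ((d / Y)⁻¹) :=
      (Real.arctan_inv_of_pos (div_pos hd hY)).symm
    have h3 : Real.arctan ((d / Y)⁻¹) ≤ (d / Y)⁻¹ := arctan_le_self (by positivity)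
    have h4 : (d / Y)⁻¹ = Y / d := by rw [inv_div]
    linarith
  · have h := arctan_sub_arctan_le (q := d / Y) (p := (d + (b' - a')) / Y) (by positivity)
      (div_le_div_of_nonneg_right (by linarith) hY.le)
    have e3 : ((d + (b' - a')) / Y - d / Y) / (1 + (d / Y) ^ 2) =
        (b' - a') * Y / (Y ^ 2 + d ^ 2) := by
      field_simp
      ring
    rw [e3] at h
    exact h


/-! ## The out-of-window profiles are dominated by Poisson sums at height `η` -/

/-- Pointwise domination: for `z ∉ [a, b]`, `a + η ≤ b − η`, `Y, η > 0`, the profile of `z` over the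
shrunk window `[a+η, b−η]` at scale `Y` is at most
`(b − a − 2η)·(2Y/η)·(η/((a+η−z)² + η²) + η/((b−η−z)² + η²))` — second-order decay
`(b′−a′)Y/d²` at distance `d ≥ η`, and `Y/d² ≤ (2Y/η)·η/(d² + η²)`. [folklore] -/
private theorem indicator_profile_le {a b η Y z : ℝ} (hY : 0 < Y) (hη : 0 < η) (hab : a + η ≤ b - η)
    (hz : z ∉ Icc a b) :
    Real.arctan ((b - η - z) / Y) - Real.arctan ((a + η - z) / Y) ≤
      (b - a - 2 * η) * (2 * Y / η) *
        (η / ((a + η - z) ^ 2 + η ^ 2) + η / ((b - η - z) ^ 2 + η ^ 2)) := by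
  have hw : 0 ≤ b - a - 2 * η := by linarith
  have hkA : 0 ≤ η / ((a + η - z) ^ 2 + η ^ 2) := by positivity
  have hkB : 0 ≤ η / ((b - η - z) ^ 2 + η ^ 2) := by positivity
  rw [mem_Icc, not_and_or, not_le, not_le] at hz
  -- the elementary comparison `Y/(Y²+d²) ≤ (2Y/η)·η/(d²+η²)` for `d ≥ η`
  have cmp : ∀ d : ℝ, η ≤ d → Y / (Y ^ 2 + d ^ 2) ≤ 2 * Y / η * (η / (d ^ 2 + η ^ 2)) := by
    intro d hd
    have hd0 : 0 < d := lt_of_lt_of_le hη hd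
    rw [div_le_iff₀ (by positivity)]
    have e : 2 * Y / η * (η / (d ^ 2 + η ^ 2)) * (Y ^ 2 + d ^ 2) =
        2 * Y * (Y ^ 2 + d ^ 2) / (d ^ 2 + η ^ 2) := by
      field_simp
    rw [e, le_div_iff₀ (by positivity)]
    have : η ^ 2 ≤ d ^ 2 := pow_le_pow_left₀ hη.le hd 2
    nlinarith [sq_nonneg Y, sq_nonneg d]
  rcases hz with hlt | hgt
  · -- `z < a`: distance `d = (a + η) − z ≥ η` to the left
    set d : ℝ := a + η - z with hd
    have hdη : η ≤ d := by rw [hd]; linarith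
    have hz' : z = (a + η) - d := by rw [hd]; ring
    have h := (profile_le_of_left (a' := a + η) (b' := b - η) (d := d) hY hab
      (lt_of_lt_of_le hη hdη)).2
    rw [← hz'] at h
    have e1 : b - η - (a + η) = b - a - 2 * η := by ring
    rw [e1] at h
    calc Real.arctan ((b - η - z) / Y) - Real.arctan ((a + η - z) / Y)
        ≤ (b - a - 2 * η) * Y / (Y ^ 2 + d ^ 2) := h
      _ = (b - a - 2 * η) * (Y / (Y ^ 2 + d ^ 2)) := by ring
      _ ≤ (b - a - 2 * η) * (2 * Y / η * (η / (d ^ 2 + η ^ 2))) :=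
          mul_le_mul_of_nonneg_left (cmp d hdη) hw
      _ = (b - a - 2 * η) * (2 * Y / η) * (η / ((a + η - z) ^ 2 + η ^ 2)) := by rw [hd]; ring
      _ ≤ _ := by
          have : 0 ≤ (b - a - 2 * η) * (2 * Y / η) := by positivity
          nlinarith
  · -- `b < z`: distance `d = z − (b − η) ≥ η` to the right
    set d : ℝ := z - (b - η) with hd
    have hdη : η ≤ d := by rw [hd]; linarith
    have hz' : z = (b - η) + d := by rw [hd]; ring
    have h := profile_le_mul_div_sq_of_right (a' := a + η) (b' := b - η) (d := d) hY hab
      (lt_of_lt_of_le hη hdη)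
    rw [← hz'] at h
    have e1 : b - η - (a + η) = b - a - 2 * η := by ring
    rw [e1] at h
    have e2 : (b - η - z) ^ 2 = d ^ 2 := by rw [hd]; ring
    calc Real.arctan ((b - η - z) / Y) - Real.arctan ((a + η - z) / Y)
        ≤ (b - a - 2 * η) * Y / (Y ^ 2 + d ^ 2) := h
      _ = (b - a - 2 * η) * (Y / (Y ^ 2 + d ^ 2)) := by ring
      _ ≤ (b - a - 2 * η) * (2 * Y / η * (η / (d ^ 2 + η ^ 2))) :=
          mul_le_mul_of_nonneg_left (cmp d hdη) hw
      _ = (b - a - 2 * η) * (2 * Y / η) * (η / ((b - η - z) ^ 2 + η ^ 2)) := by rw [e2]; ring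
      _ ≤ _ := by
          have : 0 ≤ (b - a - 2 * η) * (2 * Y / η) := by positivity
          nlinarith

/-- **The out-of-window profiles are dominated by two Poisson sums at height `η`.** For `t` above
a real-rooted time, `Y, η > 0`, `a + η ≤ b − η`: the remainder term of
`mul_le_pi_mul_deBruijnZeroCount_add_tsum` satisfies
`Σ_j (out-of-window profiles) ≤ (b − a − 2η)·(2Y/η)·(Im (H_t′/H_t)((a+η) − iη) + Im (H_t′/H_t)((b−η) − iη))`
— every zero outside `[a, b]` is at distance `≥ η` from the shrunk window, where its profile at
scale `Y` is `≤ (b−a−2η)Y/d² ≤ (b−a−2η)(2Y/η)·(Poisson kernel at height η)`, and the Poisson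
kernels over all zeros sum to `Im H_t′/H_t` at height `η` (`im_logDeriv_deBruijnH_eq_tsum`). With
`Y = δ log₊T`, `η = η₀ log₊T` and `Im H_t′/H_t ≈ log₊T/4` at height `η` (stage B) the remainder is
`O((δ/η₀)·(b − a)·log₊T) = O(δ/η₀)·α log²₊T`: negligible for `δ ≪ η₀`. This replaces the
`O(√δ) log²₊T` estimate of the vertical contributions `Γ_I`, `Γ_III` in the printed proof (p. 25).
[cite: RodgersTaoFMP2020, Theorem 9 (49) proof p.25 (the Γ_I/Γ_III boundary contributions)] -/
theorem tsum_outside_profiles_le {t : ℝ}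
    (hΛ : ∃ t₁ : ℝ, t₁ < t ∧ HasOnlyRealZeros (deBruijnH t₁)) {Y η a b : ℝ} (hY : 0 < Y)
    (hη : 0 < η) (hab : a + η ≤ b - η) :
    ∑' j : ℕ, ({j : ℕ | deBruijnZero t (j + 1) ∈ Icc a b}ᶜ.indicator
          (fun j ↦ Real.arctan ((b - η - deBruijnZero t (j + 1)) / Y) -
            Real.arctan ((a + η - deBruijnZero t (j + 1)) / Y)) j +
        {j : ℕ | -deBruijnZero t (j + 1) ∈ Icc a b}ᶜ.indicator
          (fun j ↦ Real.arctan ((b - η + deBruijnZero t (j + 1)) / Y) -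
            Real.arctan ((a + η + deBruijnZero t (j + 1)) / Y)) j) ≤
      (b - a - 2 * η) * (2 * Y / η) *
        ((logDeriv (deBruijnH t) (((a + η : ℝ) : ℂ) - η * I)).im +
          (logDeriv (deBruijnH t) (((b - η : ℝ) : ℂ) - η * I)).im) := by
  classical
  set C₀ : ℝ := (b - a - 2 * η) * (2 * Y / η) with hC₀
  have hw0 : 0 ≤ b - a - 2 * η := by linarith
  have hC₀0 : 0 ≤ C₀ := by
    show 0 ≤ (b - a - 2 * η) * (2 * Y / η)
    positivity
  -- profiles and their summability
  set pA : ℕ → ℝ := fun j ↦ Real.arctan ((b - η - deBruijnZero t (j + 1)) / Y) -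
    Real.arctan ((a + η - deBruijnZero t (j + 1)) / Y) with hpA
  set pB : ℕ → ℝ := fun j ↦ Real.arctan ((b - η + deBruijnZero t (j + 1)) / Y) -
    Real.arctan ((a + η + deBruijnZero t (j + 1)) / Y) with hpB
  set JA : Set ℕ := {j : ℕ | deBruijnZero t (j + 1) ∈ Icc a b} with hJA
  set JB : Set ℕ := {j : ℕ | -deBruijnZero t (j + 1) ∈ Icc a b} with hJB
  have hsumAB : HasSum (fun j ↦ pA j + pB j)
      (∫ u in (a + η)..(b - η), (logDeriv (deBruijnH t) ((u : ℂ) - Y * I)).im) :=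
    hasSum_arctan_profile hΛ hY (a + η) (b - η)
  have hpA0 : ∀ j, 0 ≤ pA j := fun j ↦ by
    have := Real.arctan_mono (div_le_div_of_nonneg_right
      (by linarith : a + η - deBruijnZero t (j + 1) ≤ b - η - deBruijnZero t (j + 1)) hY.le)
    simp only [hpA]; linarith
  have hpB0 : ∀ j, 0 ≤ pB j := fun j ↦ by
    have := Real.arctan_mono (div_le_div_of_nonneg_right
      (by linarith : a + η + deBruijnZero t (j + 1) ≤ b - η + deBruijnZero t (j + 1)) hY.le)
    simp only [hpB]; linarith
  have hsA : Summable pA :=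
    hsumAB.summable.of_nonneg_of_le hpA0 fun j ↦ by linarith [hpB0 j]
  have hsB : Summable pB :=
    hsumAB.summable.of_nonneg_of_le hpB0 fun j ↦ by linarith [hpA0 j]
  have hindA0 : ∀ j, 0 ≤ JAᶜ.indicator pA j := fun j ↦ Set.indicator_nonneg (fun _ _ ↦ hpA0 _) j
  have hindB0 : ∀ j, 0 ≤ JBᶜ.indicator pB j := fun j ↦ Set.indicator_nonneg (fun _ _ ↦ hpB0 _) j
  have hsAout : Summable (JAᶜ.indicator pA) :=
    hsA.of_nonneg_of_le hindA0 fun j ↦ Set.indicator_le_self' (fun _ _ ↦ hpA0 _) j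
  have hsBout : Summable (JBᶜ.indicator pB) :=
    hsB.of_nonneg_of_le hindB0 fun j ↦ Set.indicator_le_self' (fun _ _ ↦ hpB0 _) j
  -- the dominating Poisson families at height `η`
  set kA : ℕ → ℝ := fun j ↦ η / ((a + η - deBruijnZero t (j + 1)) ^ 2 + η ^ 2) +
    η / ((a + η + deBruijnZero t (j + 1)) ^ 2 + η ^ 2) with hkA
  set kB : ℕ → ℝ := fun j ↦ η / ((b - η - deBruijnZero t (j + 1)) ^ 2 + η ^ 2) +
    η / ((b - η + deBruijnZero t (j + 1)) ^ 2 + η ^ 2) with hkB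
  have hskA : Summable kA := summable_poisson_terms hΛ (a + η) hη
  have hskB : Summable kB := summable_poisson_terms hΛ (b - η) hη
  have htA : ∑' j, kA j = (logDeriv (deBruijnH t) (((a + η : ℝ) : ℂ) - η * I)).im :=
    (im_logDeriv_deBruijnH_eq_tsum hΛ (a + η) hη).symm
  have htB : ∑' j, kB j = (logDeriv (deBruijnH t) (((b - η : ℝ) : ℂ) - η * I)).im :=
    (im_logDeriv_deBruijnH_eq_tsum hΛ (b - η) hη).symm
  -- termwise domination
  have hdom : ∀ j, JAᶜ.indicator pA j + JBᶜ.indicator pB j ≤ C₀ * (kA j + kB j) := by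
    intro j
    set x : ℝ := deBruijnZero t (j + 1) with hx
    have hkx : ∀ z : ℝ, 0 ≤ η / ((a + η - z) ^ 2 + η ^ 2) + η / ((b - η - z) ^ 2 + η ^ 2) :=
      fun z ↦ by positivity
    -- the `x_{j+1}` term
    have h1 : JAᶜ.indicator pA j ≤
        C₀ * (η / ((a + η - x) ^ 2 + η ^ 2) + η / ((b - η - x) ^ 2 + η ^ 2)) := by
      by_cases hj : j ∈ JAᶜ
      · rw [Set.indicator_of_mem hj]
        exact indicator_profile_le hY hη hab hj
      · rw [Set.indicator_of_notMem hj]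
        exact mul_nonneg hC₀0 (hkx x)
    -- the `−x_{j+1}` term
    have h2 : JBᶜ.indicator pB j ≤
        C₀ * (η / ((a + η + x) ^ 2 + η ^ 2) + η / ((b - η + x) ^ 2 + η ^ 2)) := by
      by_cases hj : j ∈ JBᶜ
      · rw [Set.indicator_of_mem hj]
        have h := indicator_profile_le (z := -x) hY hη hab hj
        simp only [sub_neg_eq_add] at h
        exact h
      · rw [Set.indicator_of_notMem hj]
        have := hkx (-x)
        simp only [sub_neg_eq_add] at this
        exact mul_nonneg hC₀0 this
    have e : C₀ * (kA j + kB j) =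
        C₀ * (η / ((a + η - x) ^ 2 + η ^ 2) + η / ((b - η - x) ^ 2 + η ^ 2)) +
        C₀ * (η / ((a + η + x) ^ 2 + η ^ 2) + η / ((b - η + x) ^ 2 + η ^ 2)) := by
      simp only [hkA, hkB, hx]; ring
    rw [e]
    exact add_le_add h1 h2
  -- sum up
  calc ∑' j, (JAᶜ.indicator pA j + JBᶜ.indicator pB j)
      ≤ ∑' j, C₀ * (kA j + kB j) :=
        (hsAout.add hsBout).tsum_le_tsum hdom ((hskA.add hskB).mul_left C₀)
    _ = C₀ * ((logDeriv (deBruijnH t) (((a + η : ℝ) : ℂ) - η * I)).im +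
          (logDeriv (deBruijnH t) (((b - η : ℝ) : ℂ) - η * I)).im) := by
        rw [tsum_mul_left, hskA.tsum_add hskB, htA, htB]


/-! ## Stage C assembled at one window: the count of `[T, T + αL]` from Poisson control at heights `δL`, `η₀L` -/

/-- **Upper count of a window from Poisson control** (stage C, upper half, at one `T`). Let `t` lie
above a real-rooted time, `L > 0`, `0 < δ`, `0 < η₀`, `α ≥ 0`, and suppose
`Im (H_t′/H_t)(u − iδL) ≤ (1/4 + E)·L` for `u ∈ [T − η₀L, T + (α + η₀)L]`. Then
`N_t([T, T + αL]) · 2 arctan(η₀/δ) ≤ (1/4 + E)(α + 2η₀)·L²`. (With `L = log₊ T` and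
`arctan(η₀/δ) → π/2` this is `N_t ≤ (α + 2η₀)(1/4 + E) L²/π·(1 + O(δ/η₀))`, the upper half of
(49).) [cite: RodgersTaoFMP2020, Theorem 9 (49) proof p.25] -/
theorem count_window_upper {t : ℝ}
    (hΛ : ∃ t₁ : ℝ, t₁ < t ∧ HasOnlyRealZeros (deBruijnH t₁)) {L δ η₀ α E T : ℝ} (hL : 0 < L)
    (hδ : 0 < δ) (hη₀ : 0 < η₀) (hα : 0 ≤ α)
    (hU : ∀ u ∈ Icc (T - η₀ * L) (T + α * L + η₀ * L),
      (logDeriv (deBruijnH t) ((u : ℂ) - ((δ * L : ℝ) : ℂ) * I)).im ≤ (1 / 4 + E) * L) :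
    (deBruijnZeroCount t (Icc T (T + α * L)) : ℝ) * (2 * Real.arctan (η₀ / δ)) ≤
      (1 / 4 + E) * (α + 2 * η₀) * L ^ 2 := by
  have h := deBruijnZeroCount_Icc_mul_arctan_le hΛ (Y := δ * L) (η := η₀ * L) (a := T)
    (b := T + α * L) (M := (1 / 4 + E) * L) (by positivity) (by positivity) (by nlinarith) hU
  have e1 : η₀ * L / (δ * L) = η₀ / δ := mul_div_mul_right _ _ hL.ne'
  rw [e1] at h
  calc (deBruijnZeroCount t (Icc T (T + α * L)) : ℝ) * (2 * Real.arctan (η₀ / δ))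
      ≤ (1 / 4 + E) * L * (T + α * L - T + 2 * (η₀ * L)) := h
    _ = (1 / 4 + E) * (α + 2 * η₀) * L ^ 2 := by ring

/-- **Lower count of a window from Poisson control** (stage C, lower half, at one `T`). Let `t`
lie above a real-rooted time, `L > 0`, `0 < δ`, `0 < η₀`, `2η₀ ≤ α`, `0 ≤ 1/4 + E`, and suppose
`Im (H_t′/H_t)(u − iδL) ≥ (1/4 − E)·L` for `u ∈ [T + η₀L, T + (α − η₀)L]` and
`Im (H_t′/H_t)(u − iη₀L) ≤ (1/4 + E)·L` at the two points `u = T + η₀L`, `u = T + (α − η₀)L`. Then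
`(1/4 − E)(α − 2η₀)·L² ≤ π·N_t([T, T + αL]) + α·(4δ/η₀)(1/4 + E)·L²` — the lower half of (49)
with the boundary-layer loss `O(η₀)` and the tail loss `O(δ/η₀)` explicit.
[cite: RodgersTaoFMP2020, Theorem 9 (49) proof p.25] -/
theorem count_window_lower {t : ℝ}
    (hΛ : ∃ t₁ : ℝ, t₁ < t ∧ HasOnlyRealZeros (deBruijnH t₁)) {L δ η₀ α E T : ℝ} (hL : 0 < L)
    (hδ : 0 < δ) (hη₀ : 0 < η₀) (hα : 2 * η₀ ≤ α) (hE : 0 ≤ 1 / 4 + E)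
    (hLo : ∀ u ∈ Icc (T + η₀ * L) (T + α * L - η₀ * L),
      (1 / 4 - E) * L ≤ (logDeriv (deBruijnH t) ((u : ℂ) - ((δ * L : ℝ) : ℂ) * I)).im)
    (hA : (logDeriv (deBruijnH t) (((T + η₀ * L : ℝ) : ℂ) - ((η₀ * L : ℝ) : ℂ) * I)).im ≤
      (1 / 4 + E) * L)
    (hB : (logDeriv (deBruijnH t) (((T + α * L - η₀ * L : ℝ) : ℂ) - ((η₀ * L : ℝ) : ℂ) * I)).im ≤
      (1 / 4 + E) * L) :
    (1 / 4 - E) * (α - 2 * η₀) * L ^ 2 ≤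
      π * deBruijnZeroCount t (Icc T (T + α * L)) + α * (4 * δ / η₀) * (1 / 4 + E) * L ^ 2 := by
  have hab : T + η₀ * L ≤ T + α * L - η₀ * L := by nlinarith
  have h1 := mul_le_pi_mul_deBruijnZeroCount_add_tsum hΛ (Y := δ * L) (η := η₀ * L) (a := T)
    (b := T + α * L) (m := (1 / 4 - E) * L) (by positivity) hab hLo
  have h2 := tsum_outside_profiles_le hΛ (Y := δ * L) (η := η₀ * L) (a := T) (b := T + α * L)
    (by positivity) (by positivity) hab
  -- the tail bound in closed form
  have hw : 0 ≤ T + α * L - T - 2 * (η₀ * L) := by nlinarith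
  have hw' : T + α * L - T - 2 * (η₀ * L) ≤ α * L := by nlinarith
  have e2 : 2 * (δ * L) / (η₀ * L) = 2 * δ / η₀ := by
    field_simp
  rw [e2] at h2
  have hsum : (logDeriv (deBruijnH t) (((T + η₀ * L : ℝ) : ℂ) - ((η₀ * L : ℝ) : ℂ) * I)).im +
      (logDeriv (deBruijnH t) (((T + α * L - η₀ * L : ℝ) : ℂ) - ((η₀ * L : ℝ) : ℂ) * I)).im ≤
      2 * ((1 / 4 + E) * L) := by linarith
  have htail : (T + α * L - T - 2 * (η₀ * L)) * (2 * δ / η₀) *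
      ((logDeriv (deBruijnH t) (((T + η₀ * L : ℝ) : ℂ) - ((η₀ * L : ℝ) : ℂ) * I)).im +
        (logDeriv (deBruijnH t) (((T + α * L - η₀ * L : ℝ) : ℂ) - ((η₀ * L : ℝ) : ℂ) * I)).im) ≤
      α * (4 * δ / η₀) * (1 / 4 + E) * L ^ 2 := by
    have hc : 0 ≤ (T + α * L - T - 2 * (η₀ * L)) * (2 * δ / η₀) := by positivity
    calc (T + α * L - T - 2 * (η₀ * L)) * (2 * δ / η₀) * _
        ≤ (T + α * L - T - 2 * (η₀ * L)) * (2 * δ / η₀) * (2 * ((1 / 4 + E) * L)) :=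
          mul_le_mul_of_nonneg_left hsum hc
      _ ≤ (α * L) * (2 * δ / η₀) * (2 * ((1 / 4 + E) * L)) := by
          have : 0 ≤ (2 * δ / η₀) * (2 * ((1 / 4 + E) * L)) := by positivity
          nlinarith
      _ = α * (4 * δ / η₀) * (1 / 4 + E) * L ^ 2 := by ring
  have e3 : (1 / 4 - E) * L * (T + α * L - T - 2 * (η₀ * L)) = (1 / 4 - E) * (α - 2 * η₀) * L ^ 2 := by
    ring
  rw [e3] at h1
  linarith [h1, h2, htail]

end RodgersTaoLogDerivPoisson

end Literature.NumberTheory.LFunctions
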